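import Mathlib.Data.Rat.BigOperators
import Literature.Computation.Certificates.SemidefiniteRigorousBounds
import Literature.Computation.Certificates.DyadicCholResidualWitness

/-!
# Kernel-replayable layout of `certsdp-problem/1` and the LOWER certificate kind `certsdp-conic/1` (Gram and dyadic-eig modes)

Topic `Literature/Computation/Certificates`.  This file states, in EXACT RATIONAL DATA and with a
BOOLEAN (kernel-evaluable) acceptance check, the lower-bound certificate kind behind the released call
`certsdp.aposteriori.rigorous_bound` (certnum `RELEASES.md` line 1), and proves its soundness as a
COROLLARY of `JanssonChaykinKeil.lmiForm_bound` (this directory):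

* the program (`certsdp-problem/1`, `Problem`): variables `y : V → ℝ`, unit variable `y_u = 1`,
  objective `c·y + c₀`, a-priori bounds `|y_v| ≤ ρ_v` (`none` = unbounded), equality rows, inequality
  rows `row·y ≤ upper`, PSD blocks `M_k(y) = Cb_k + Σ_v y_v F_{k,v}` (symmetric rational coefficient
  matrices — the JSON lists each unordered pair once), optional a-priori trace bounds `tr M_k(y) ≤ τ_k`;
  real semantics `Problem.Feasible`, `Problem.TraceBounds`, `Problem.obj`;
* the certificate (`certsdp-conic/1`, `LowerCert`): multipliers `λ` (free), `κ`, and per block EITHER a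
  Gram witness `Z_k = F_k F_kᵀ/4^{K}` (integer factor rows; `d_k = 0`) OR a dyadic-eig witness
  `Z_k = sym(Zl_k)/2^{K}` with a Cholesky-residual eigenvalue certificate `(K', σ, L, e)`:
  `E = 4^{K'} Z_k − 2^{K'}σ·1 − L Lᵀ`, every row sum of `|E|` `≤ e·4^{K'}`, floor
  `d_k = σ/2^{K'} − e ≤ λ_min(Z_k)`; exact residuals
  `r_v = c_v − Σ_e λ_e row_e[v] + Σ_i κ_i row_i[v] − Σ_k ⟨Z_k, F_{k,v}⟩`,
  `β = c₀ + r_u + Σ_e λ_e rhs_e − Σ_i κ_i upper_i − Σ_k ⟨Z_k, Cb_k⟩`, `ℓ₁ = Σ_{v≠u} |r_v| ρ_v`, penalty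
  `Σ_k |min(0,d_k)| τ_k`; acceptance `LowerCert.check : Bool` = «`κ ≥ 0`; unbounded variables carry
  zero residual; every eigen row check holds; `d_k < 0 ⇒ τ_k` present; `claimed ≤ β − ℓ₁ − penalty`» — the
  checks K-1…K-5 of certsdp `RIGOR-LAYER.md` §2–§3 / `verify_a.verify`;
* soundness `LowerCert.sound`: `check = true ⇒ claimed ≤ c·y + c₀` for every feasible `y` satisfying the
  a-priori trace bounds (`sound'`: the trace bounds are not needed when every `d_k ≥ 0`, e.g. pure Gram
  mode), and `le_csInf` / `le_csInf'`.  These are COROLLARIES of Jansson–Chaykin–Keil's Lemma 3.1 /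
  Theorem 3.2 mechanism in inequality form (`JanssonChaykinKeil.lmiForm_bound`) [JanssonChaykinKeil2008],
  with `Z_k ⪰ 0` by construction in Gram mode [BurerMonteiro2003, §1 (2)] and `Z_k − d_k·1 ⪰ 0` from
  Rump's residual criterion (`DyadicCholResidualWitness.posSemidef_sub_smul_one`)
  [Rump1999VerifiedLargeSystems, §4].

The checks are `Bool`-valued functions of the exact data, so a concrete certificate (rational literals
transcribed from the JSON files) is replayed IN THE KERNEL by `decide` on `check = true` — the Lean kernel
as a further reader beside the readers of record (small instances; the point is the field-by-field identity
of the typed statement with what the readers check).  The UPPER kind `certsdp-primal/1` is the sibling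
file `ConicCertificateLayoutPrimal`.  NOT covered: interval problem data; the informational members
(`diag_shift_scaled`, float shadows).  No named facts, no instances, no `sorry`; everything stated is proved.
-/

namespace Literature.Computation.Certificates

open Matrix Finset
open scoped BigOperators

namespace ConicLayout

/-! ### §1 `certsdp-problem/1` and its real semantics -/

/-- The data of a conic program in inequality (LMI, "y-") form, `certsdp-problem/1` (members `unit_var`,
`objective`, `bounds`, `eq_rows`, `ineq_rows`, `psd_blocks[{const, entries, trace_bound}]`) — the block
semidefinite program of Jansson–Chaykin–Keil written for the unknown `y` with the a-priori bounds their
Theorem 3.2 charges the residuals against. [cite: JanssonChaykinKeil2008, §3 (block SDP data of Thm 3.2,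
inequality form)] -/
structure Problem (V E I K : Type*) (σ : K → Type*) where
  /-- index of the unit variable `y_u = 1` -/
  unit : V
  /-- objective row `c` -/
  c : V → ℚ
  /-- objective constant `c₀` -/
  c0 : ℚ
  /-- a-priori bounds `|y_v| ≤ ρ_v`; `none` = unbounded -/
  rho : V → Option ℚ
  /-- equality rows -/
  rowE : E → V → ℚ
  /-- right-hand sides of the equality rows -/
  rhs : E → ℚ
  /-- inequality rows (`≤ upper`) -/
  rowI : I → V → ℚ
  /-- upper sides of the inequality rows -/
  upper : I → ℚ
  /-- constant parts `Cb_k` of the PSD blocks (symmetric) -/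
  Cb : ∀ k, Matrix (σ k) (σ k) ℚ
  /-- coefficient matrices `F_{k,v}` of the PSD blocks (symmetric) -/
  F : ∀ k, V → Matrix (σ k) (σ k) ℚ
  /-- optional a-priori trace bounds `tr M_k(y) ≤ τ_k` -/
  tau : K → Option ℚ

variable {V E I K : Type*} [Fintype V] [DecidableEq V] [Fintype E] [Fintype I] [Fintype K]
variable {σ : K → Type*} [∀ k, Fintype (σ k)] [∀ k, DecidableEq (σ k)]
variable {π : K → Type*} [∀ k, Fintype (π k)]

namespace Problem

/-- The block `M_k(y) = Cb_k + Σ_v y_v F_{k,v}` at a RATIONAL point, entrywise (exact). [folklore] -/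
def blockQ (P : Problem V E I K σ) (k : K) (y : V → ℚ) : Matrix (σ k) (σ k) ℚ :=
  fun a b => P.Cb k a b + ∑ v, y v * P.F k v a b

/-- The block `M_k(y) = Cb_k + Σ_v y_v F_{k,v}` at a REAL point (the semantics). [folklore] -/
noncomputable def block (P : Problem V E I K σ) (k : K) (y : V → ℝ) : Matrix (σ k) (σ k) ℝ :=
  (P.Cb k).map (Rat.cast : ℚ → ℝ) + ∑ v, y v • (P.F k v).map (Rat.cast : ℚ → ℝ)

/-- The objective `c·y + c₀` at a real point. [folklore] -/
noncomputable def obj (P : Problem V E I K σ) (y : V → ℝ) : ℝ :=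
  ∑ v, (P.c v : ℝ) * y v + P.c0

/-- **Feasibility** of a real point `y`: `y_u = 1`, the a-priori bounds, the equality and inequality
rows, and `M_k(y) ⪰ 0` for every block — the feasible set whose optimal value the certificates bound
(the hypothesis list of [cite: JanssonChaykinKeil2008, Thm 3.2 (inequality form)]; certsdp
`RIGOR-LAYER.md` §1). -/
structure Feasible (P : Problem V E I K σ) (y : V → ℝ) : Prop where
  /-- the unit variable -/
  unit : y P.unit = 1
  /-- a-priori bounds -/
  box : ∀ v, ∀ q ∈ P.rho v, |y v| ≤ (q : ℝ)
  /-- equality rows -/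
  eq : ∀ e, ∑ v, (P.rowE e v : ℝ) * y v = P.rhs e
  /-- inequality rows -/
  le : ∀ i, ∑ v, (P.rowI i v : ℝ) * y v ≤ P.upper i
  /-- PSD blocks -/
  psd : ∀ k, (P.block k y).PosSemidef

/-- The a-priori TRACE BOUNDS `tr M_k(y) ≤ τ_k` (where declared) hold at `y` — the side information a
penalised (`d_k < 0`) block is charged against. [cite: JanssonChaykinKeil2008, Thm 3.2 (a-priori
bound `x̄` on the primal object)] -/
def TraceBounds (P : Problem V E I K σ) (y : V → ℝ) : Prop :=
  ∀ k, ∀ q ∈ P.tau k, (P.block k y).trace ≤ (q : ℝ)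

end Problem

/-! ### §2 Exact plumbing shared by the certificate kinds -/

/-- The pairing `⟨Z, F⟩ = Σ_a Σ_b Z_ab F_ba` (`= tr (Z F)`; for symmetric data listed once per unordered
pair this is `Σ_a Z_aa F_aa + 2 Σ_{a<b} Z_ab F_ab`, K-1 of the reader spec). [folklore] -/
def pairing {m : Type*} [Fintype m] (Z F : Matrix m m ℚ) : ℚ :=
  ∑ a, ∑ b, Z a b * F b a

/-- The exact Cholesky residual `E = (2ˢ)²·(d·M) − 2ˢσ·1 − L Lᵀ` of a rational matrix `M` for an integer
lower factor `L`, entrywise (RIGOR-LAYER §3; `certsdp-primal/1` chol-residual). [folklore] -/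
def cholResidual {m : Type*} [Fintype m] [DecidableEq m] (M : Matrix m m ℚ) (d s : ℕ) (sg : ℤ)
    (L : Matrix m m ℤ) : Matrix m m ℚ :=
  fun i j => (2 : ℚ) ^ s * (2 : ℚ) ^ s * ((d : ℚ) * M i j) -
    (if i = j then (2 : ℚ) ^ s * (sg : ℚ) else 0) - ∑ l, (L i l : ℚ) * L j l

omit [Fintype V] [DecidableEq V] [Fintype E] [Fintype I] [Fintype K] in
/-- `tr (Z F) = ⟨Z, F⟩` after casting to `ℝ`. [folklore] -/
private theorem trace_map_mul_map {m : Type*} [Fintype m] (Z F : Matrix m m ℚ) :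
    trace (Z.map (Rat.cast : ℚ → ℝ) * F.map (Rat.cast : ℚ → ℝ)) = (pairing Z F : ℝ) := by
  simp [Matrix.trace, Matrix.mul_apply, pairing, Rat.cast_sum, Rat.cast_mul]

omit [Fintype V] [DecidableEq V] [Fintype E] [Fintype I] [Fintype K] in
/-- The reader's exact residual is Rump's residual `t²·(d·M) − tσ·1 − RᴴR` of
`DyadicCholResidualWitness` with `t = 2ˢ`, `R = Lᵀ`. [folklore] -/
private theorem residual_eq_cholResidual {m : Type*} [Fintype m] [DecidableEq m] (M : Matrix m m ℚ)
    (d s : ℕ) (sg : ℤ) (L : Matrix m m ℤ) (i j : m) :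
    DyadicCholResidualWitness.residual (M.map (Rat.cast : ℚ → ℝ)) ((L.map (Int.cast : ℤ → ℝ))ᵀ)
      (d : ℝ) ((2 : ℝ) ^ s) (sg : ℝ) i j = (cholResidual M d s sg L i j : ℝ) := by
  simp only [DyadicCholResidualWitness.residual, RCLike.ofReal_real_eq_id, id,
    conjTranspose_eq_transpose_of_trivial, Matrix.transpose_transpose, Matrix.sub_apply,
    Matrix.smul_apply, Matrix.map_apply, Matrix.one_apply, Matrix.mul_apply, Matrix.transpose_apply,
    smul_eq_mul, cholResidual, Rat.cast_sub, Rat.cast_mul, Rat.cast_pow, Rat.cast_ofNat,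
    Rat.cast_natCast, Rat.cast_intCast, Rat.cast_sum]
  split_ifs <;> simp <;> ring

omit [Fintype V] [DecidableEq V] [Fintype E] [Fintype I] [Fintype K] in
/-- **Rump's residual criterion in the reader's layout**: if `M` is symmetric, `d > 0`, every row sum
of `|E|`, `E = (2ˢ)²(d·M) − 2ˢσ·1 − LLᵀ`, is `≤ r`, and `c·((2ˢ)²d) = 2ˢσ − r`, then `M − c·1 ⪰ 0` over `ℝ`
(`c = (2ˢσ − r)/((2ˢ)²d)`, Rump's `λ_min ≥ s − ‖Δ‖` rescaled).
[cite: Rump1999VerifiedLargeSystems, §4 eq. after (12) and Algorithm 4.1 step 7] -/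
theorem posSemidef_sub_of_rowSums {m : Type*} [Fintype m] [DecidableEq m] {M : Matrix m m ℚ}
    (hsymm : ∀ i j, M i j = M j i) {d s : ℕ} (hd : 0 < d) {sg : ℤ} {L : Matrix m m ℤ} {r c : ℚ}
    (hrow : ∀ i, ∑ j, |cholResidual M d s sg L i j| ≤ r)
    (hc : c * ((2 : ℚ) ^ s * (2 : ℚ) ^ s * d) = (2 : ℚ) ^ s * sg - r) :
    (M.map (Rat.cast : ℚ → ℝ) - (c : ℝ) • (1 : Matrix m m ℝ)).PosSemidef := by
  have hM : (M.map (Rat.cast : ℚ → ℝ)).IsHermitian := by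
    rw [Matrix.IsHermitian, conjTranspose_eq_transpose_of_trivial]
    ext i j
    simp [hsymm j i]
  have h := DyadicCholResidualWitness.posSemidef_sub_smul_one (𝕜 := ℝ) hM
    ((L.map (Int.cast : ℤ → ℝ))ᵀ) (d := (d : ℝ)) (t := (2 : ℝ) ^ s) (σ := (sg : ℝ)) (r := (r : ℝ))
    (by exact_mod_cast hd) (by positivity) (fun i => by
      have hsum : ∑ j, ‖DyadicCholResidualWitness.residual (M.map (Rat.cast : ℚ → ℝ))
          ((L.map (Int.cast : ℤ → ℝ))ᵀ) (d : ℝ) ((2 : ℝ) ^ s) (sg : ℝ) i j‖ =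
          ((∑ j, |cholResidual M d s sg L i j| : ℚ) : ℝ) := by
        rw [Rat.cast_sum]
        exact Finset.sum_congr rfl fun j _ => by
          rw [residual_eq_cholResidual, Real.norm_eq_abs, Rat.cast_abs]
      rw [hsum]
      exact_mod_cast hrow i)
  have hden : ((2 : ℝ) ^ s) ^ 2 * (d : ℝ) ≠ 0 := by positivity
  have e : ((2 : ℝ) ^ s * (sg : ℝ) - (r : ℝ)) / (((2 : ℝ) ^ s) ^ 2 * (d : ℝ)) = ((c : ℚ) : ℝ) := by
    rw [div_eq_iff hden]
    have := congrArg (Rat.cast : ℚ → ℝ) hc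
    push_cast at this
    linarith
  rw [e] at h
  simpa only [RCLike.ofReal_real_eq_id, id] using h

/-! ### §3 `certsdp-conic/1`: the rigorous LOWER bound -/

/-- The PSD multiplier of one block as the certificate carries it: GRAM mode (`psd[k] = {mode: "gram",
K, factor_rows}`, `Z = F Fᵀ/4^K`) or DYADIC-EIG mode (`{mode: "dyadic-eig", K, Z_scaled_lower, eig:
{K', sigma_scaled, R_scaled_lower, E_inf_norm}}`, `Z = sym(Zl)/2^K` with a Cholesky-residual eigenvalue
certificate) — the approximate dual block with its certified eigenvalue defect `d_k` of
[cite: JanssonChaykinKeil2008, Thm 3.2 (dual approximation ỹ, defects d_j)], the defect certified by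
Rump's residual test [cite: Rump1999VerifiedLargeSystems, §4, Algorithm 4.1 step 7]. -/
inductive BlockWitness (m p : Type*) where
  /-- Gram mode: exponent `K` and integer factor rows `F` (zero-extended) -/
  | gram (expo : ℕ) (fac : Matrix m p ℤ)
  /-- dyadic-eig mode: exponent `K`, integer lower triangle `Zl`, and the eigenvalue certificate
  `(K', σ, L, e)` (`eig.K`, `eig.sigma_scaled`, `eig.R_scaled_lower`, `eig.E_inf_norm`) -/
  | dyadicEig (expo : ℕ) (Zl : Matrix m m ℤ) (eigExpo : ℕ) (sigma : ℤ) (L : Matrix m m ℤ) (einf : ℚ)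

namespace BlockWitness

variable {m p : Type*} [Fintype m] [DecidableEq m] [Fintype p]

/-- The exact multiplier `Z`: `F Fᵀ/4^K` (Gram) or the symmetrised `Zl/2^K` (dyadic-eig). [folklore] -/
def Z : BlockWitness m p → Matrix m m ℚ
  | gram K F => fun a b => (∑ j, (F a j : ℚ) * F b j) / 4 ^ K
  | dyadicEig K Zl _ _ _ _ => fun a b =>
      ((Zl a b : ℚ) + Zl b a - if a = b then (Zl a b : ℚ) else 0) / 2 ^ K

/-- The certified eigenvalue floor `d ≤ λ_min(Z)`: `0` (Gram) or `σ/2^{K'} − e` (dyadic-eig;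
`eig.lower_bound`). [folklore] -/
def dfloor : BlockWitness m p → ℚ
  | gram _ _ => 0
  | dyadicEig _ _ eK sg _ e => (sg : ℚ) / 2 ^ eK - e

/-- The eigenvalue-certificate check (K-3, dyadic-eig only): every row sum of `|E|`,
`E = 4^{K'} Z − 2^{K'}σ·1 − L Lᵀ`, is `≤ e·4^{K'}` (the reader RECOMPUTES the row sums; `e` is the
certificate's claim `E_inf_norm`); `true` in Gram mode (nothing to check). [folklore] -/
def rowsOk : BlockWitness m p → Bool
  | gram _ _ => true
  | dyadicEig K Zl eK sg L e =>
      decide (∀ i, ∑ j, |cholResidual (Z (dyadicEig K Zl eK sg L e : BlockWitness m p)) 1 eK sg L i j| ≤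
        e * 4 ^ eK)

omit [Fintype m] in
/-- The Gram multiplier is a real Gram matrix: `Z = W Wᵀ` with `W = 2^{-K} F`. [folklore] -/
private theorem gram_map_eq (K' : ℕ) (F : Matrix m p ℤ) :
    (Z (gram K' F : BlockWitness m p)).map (Rat.cast : ℚ → ℝ) =
      (((2 : ℝ) ^ K')⁻¹ • F.map (Int.cast : ℤ → ℝ)) *
        (((2 : ℝ) ^ K')⁻¹ • F.map (Int.cast : ℤ → ℝ))ᵀ := by
  ext a b
  have h4 : (4 : ℝ) ^ K' = (2 : ℝ) ^ K' * (2 : ℝ) ^ K' := by rw [← mul_pow]; norm_num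
  simp only [Z, Matrix.map_apply, Matrix.mul_apply, Matrix.smul_apply, Matrix.transpose_apply,
    smul_eq_mul, Rat.cast_div, Rat.cast_sum, Rat.cast_mul, Rat.cast_intCast, Rat.cast_pow,
    Rat.cast_ofNat]
  simp_rw [mul_mul_mul_comm ((2 : ℝ) ^ K')⁻¹ _ ((2 : ℝ) ^ K')⁻¹ _]
  rw [← Finset.mul_sum, h4, div_eq_inv_mul, mul_inv]

omit [Fintype m] in
/-- The multiplier is symmetric. [folklore] -/
private theorem Z_symm (w : BlockWitness m p) (a b : m) : w.Z a b = w.Z b a := by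
  cases w with
  | gram K F => simp only [Z]; exact congrArg (· / _) (Finset.sum_congr rfl fun j _ => mul_comm _ _)
  | dyadicEig K Zl eK sg L e =>
      simp only [Z]
      by_cases h : a = b
      · subst h; rfl
      · rw [if_neg h, if_neg (Ne.symm h)]; ring

/-- **The multiplier dominates its floor**: `Z − d·1 ⪰ 0` over `ℝ` whenever the eigen row check holds
(Gram: `d = 0` and `Z = WWᵀ`; dyadic-eig: Rump's criterion with `t = 2^{K'}`, `d = 1`).
[cite: BurerMonteiro2003, §1 eq. (2)] [cite: Rump1999VerifiedLargeSystems, §4, Algorithm 4.1 step 7] -/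
theorem posSemidef_sub_dfloor (w : BlockWitness m p) (h : w.rowsOk = true) :
    (w.Z.map (Rat.cast : ℚ → ℝ) - (w.dfloor : ℝ) • (1 : Matrix m m ℝ)).PosSemidef := by
  cases w with
  | gram K F =>
      simp only [dfloor, Rat.cast_zero, zero_smul, sub_zero, gram_map_eq]
      simpa only [conjTranspose_eq_transpose_of_trivial] using
        posSemidef_self_mul_conjTranspose (((2 : ℝ) ^ K)⁻¹ • F.map (Int.cast : ℤ → ℝ))
  | dyadicEig K Zl eK sg L e =>
      have hrow : ∀ i, ∑ j, |cholResidual (Z (dyadicEig K Zl eK sg L e : BlockWitness m p)) 1 eK sg L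
          i j| ≤ e * 4 ^ eK := by simpa only [rowsOk, decide_eq_true_eq] using h
      have h2 : (2 : ℚ) ^ eK ≠ 0 := pow_ne_zero _ two_ne_zero
      have h4 : (4 : ℚ) ^ eK = (2 : ℚ) ^ eK * (2 : ℚ) ^ eK := by rw [← mul_pow]; norm_num
      have hc : dfloor (dyadicEig K Zl eK sg L e : BlockWitness m p) *
          ((2 : ℚ) ^ eK * (2 : ℚ) ^ eK * (1 : ℕ)) = (2 : ℚ) ^ eK * sg - e * 4 ^ eK := by
        simp only [dfloor, Nat.cast_one, mul_one, h4]
        field_simp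
      exact posSemidef_sub_of_rowSums (Z_symm (dyadicEig K Zl eK sg L e : BlockWitness m p))
        Nat.one_pos hrow hc

end BlockWitness

/-- A lower-bound certificate (`certsdp-conic/1`): multipliers `λ` (`multipliers.eq`), `κ`
(`multipliers.ineq`), one `BlockWitness` per block (`psd[k]`), and `claimed.lower_bound` — the data of
the rigorous lower bound of [cite: JanssonChaykinKeil2008, Thm 3.2 (inequality-form corollary; certsdp
RIGOR-LAYER §2)]. -/
structure LowerCert (V E I K : Type*) (σ π : K → Type*) where
  /-- equality multipliers `λ_e` (free sign) -/
  lam : E → ℚ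
  /-- inequality multipliers `κ_i` (must be `≥ 0`) -/
  kap : I → ℚ
  /-- the PSD multipliers, block by block -/
  wit : ∀ k, BlockWitness (σ k) (π k)
  /-- `claimed.lower_bound` -/
  lowerBound : ℚ

namespace LowerCert

/-- The exact residual `r_v = c_v − Σ_e λ_e row_e[v] + Σ_i κ_i row_i[v] − Σ_k ⟨Z_k, F_{k,v}⟩` (K-1).
[folklore] -/
def residual (P : Problem V E I K σ) (C : LowerCert V E I K σ π) (v : V) : ℚ :=
  P.c v - ∑ e, C.lam e * P.rowE e v + ∑ i, C.kap i * P.rowI i v -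
    ∑ k, pairing (C.wit k).Z (P.F k v)

/-- `β = c₀ + r_u + Σ_e λ_e rhs_e − Σ_i κ_i upper_i − Σ_k ⟨Z_k, Cb_k⟩` (`claimed.beta`). [folklore] -/
def beta (P : Problem V E I K σ) (C : LowerCert V E I K σ π) : ℚ :=
  P.c0 + residual P C P.unit + ∑ e, C.lam e * P.rhs e - ∑ i, C.kap i * P.upper i -
    ∑ k, pairing (C.wit k).Z (P.Cb k)

/-- The `ℓ₁` charge `Σ_{v ≠ u} |r_v| ρ_v` (`claimed.l1_term`; an unbounded variable is charged `0` and must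
carry `r_v = 0`, K-4). [folklore] -/
def l1 (P : Problem V E I K σ) (C : LowerCert V E I K σ π) : ℚ :=
  ∑ v ∈ univ.erase P.unit, |residual P C v| * (P.rho v).getD 0

/-- The trace penalty `Σ_k |min(0, d_k)| τ_k` (`claimed.trace_penalty`; a block with `d_k < 0` must carry
a trace bound, K-5). [folklore] -/
def penalty (P : Problem V E I K σ) (C : LowerCert V E I K σ π) : ℚ :=
  ∑ k, |min 0 (C.wit k).dfloor| * (P.tau k).getD 0

/-- **Acceptance of a lower certificate** (what `verify_a` decides, exactly): `κ ≥ 0` (K-2); zero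
residual on unbounded variables (K-4); the eigen row checks (K-3); a trace bound wherever `d_k < 0`
(K-5); and `claimed ≤ β − ℓ₁ − penalty` (the bound formula of certsdp `RIGOR-LAYER.md` §2).  A `Bool`
of the exact data (kernel-evaluable by `decide`). [folklore] -/
def check (P : Problem V E I K σ) (C : LowerCert V E I K σ π) : Bool :=
  decide (∀ i, 0 ≤ C.kap i) &&
    decide (∀ v, v ≠ P.unit → P.rho v = none → residual P C v = 0) &&
    decide (∀ k, (C.wit k).rowsOk = true) &&
    decide (∀ k, (C.wit k).dfloor < 0 → (P.tau k).isSome = true) &&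
    decide (C.lowerBound ≤ beta P C - l1 P C - penalty P C)

/-- The core estimate: an accepted certificate bounds the objective at every feasible `y`, given real
trace majorants `τ_k ≥ tr M_k(y)` whose penalty `Σ_k |min(0,d_k)| τ_k` is covered by the certificate's.
[cite: JanssonChaykinKeil2008, Lemma 3.1 and Thm 3.2 (inequality-form corollary)] -/
private theorem bound_core {P : Problem V E I K σ} {C : LowerCert V E I K σ π} (h : check P C = true)
    {y : V → ℝ} (hy : P.Feasible y) (τ : K → ℝ) (hτ : ∀ k, (P.block k y).trace ≤ τ k)
    (hpen : ∑ k, |min 0 ((C.wit k).dfloor : ℝ)| * τ k ≤ (penalty P C : ℝ)) :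
    (C.lowerBound : ℝ) ≤ P.obj y := by
  simp only [check, Bool.and_eq_true, decide_eq_true_eq] at h
  obtain ⟨⟨⟨⟨hκ, hnone⟩, hrows⟩, _⟩, hlb⟩ := h
  -- the box actually used: `ρ_v`, or `|y_v|` itself for an unbounded variable (its residual is `0`)
  let ρ : V → ℝ := fun v => (P.rho v).elim |y v| fun q => (q : ℝ)
  have hρ : ∀ v, v ≠ P.unit → |y v| ≤ ρ v := by
    intro v _
    cases hq : P.rho v with
    | none => simp [ρ, hq]
    | some q => simpa [ρ, hq] using hy.box v q (by simp [hq])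
  have hmain := JanssonChaykinKeil.lmiForm_bound (fun v => (P.c v : ℝ)) (P.c0 : ℝ) P.unit
    (fun e v => (P.rowE e v : ℝ)) (fun e => (P.rhs e : ℝ)) (fun i v => (P.rowI i v : ℝ))
    (fun i => (P.upper i : ℝ)) (fun k => (P.Cb k).map (Rat.cast : ℚ → ℝ))
    (fun k v => (P.F k v).map (Rat.cast : ℚ → ℝ)) ρ τ hy.unit hρ hy.eq hy.le hy.psd hτ
    (fun e => (C.lam e : ℝ)) (fun i => (C.kap i : ℝ)) (fun i => by exact_mod_cast hκ i)
    (fun k => (C.wit k).Z.map (Rat.cast : ℚ → ℝ)) (fun k => ((C.wit k).dfloor : ℝ))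
    (fun k => (C.wit k).posSemidef_sub_dfloor (hrows k)) (fun v => (residual P C v : ℝ))
    (fun v => by
      simp only [residual, Rat.cast_sub, Rat.cast_add, Rat.cast_sum, Rat.cast_mul,
        trace_map_mul_map])
    (beta P C : ℝ)
    (by simp only [beta, residual, Rat.cast_sub, Rat.cast_add, Rat.cast_sum, Rat.cast_mul,
      trace_map_mul_map])
  have hl1 : (l1 P C : ℝ) = ∑ v ∈ univ.erase P.unit, |(residual P C v : ℝ)| * ρ v := by
    rw [l1, Rat.cast_sum]
    refine Finset.sum_congr rfl fun v hv => ?_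
    have hvu : v ≠ P.unit := Finset.ne_of_mem_erase hv
    cases hq : P.rho v with
    | none => simp [hnone v hvu hq]
    | some q => simp [ρ, hq, Rat.cast_mul, Rat.cast_abs]
  have hlb' : (C.lowerBound : ℝ) ≤ (beta P C : ℝ) - (l1 P C : ℝ) - (penalty P C : ℝ) := by
    exact_mod_cast hlb
  rw [hl1] at hlb'
  have hobj : P.obj y = ∑ v, (P.c v : ℝ) * y v + P.c0 := rfl
  linarith

/-- **Soundness of the lower certificate** (`certsdp-conic/1`): if the certificate is accepted then
`claimed.lower_bound ≤ c·y + c₀` for every feasible `y` at which the declared a-priori trace bounds hold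
— certsdp `RIGOR-LAYER.md` §2, i.e. `JanssonChaykinKeil.lmiForm_bound` with `Z_k − d_k·1 ⪰ 0` supplied by
the block witnesses. [cite: JanssonChaykinKeil2008, Lemma 3.1 and Thm 3.2 (inequality-form corollary)]
[cite: Rump1999VerifiedLargeSystems, §4, Algorithm 4.1 step 7] -/
theorem sound {P : Problem V E I K σ} {C : LowerCert V E I K σ π} (h : check P C = true) {y : V → ℝ}
    (hy : P.Feasible y) (htr : P.TraceBounds y) : (C.lowerBound : ℝ) ≤ P.obj y := by
  have hsome : ∀ k, (C.wit k).dfloor < 0 → (P.tau k).isSome = true := by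
    have h' := h
    simp only [check, Bool.and_eq_true, decide_eq_true_eq] at h'
    exact h'.1.2
  -- trace majorants: the declared bound where present, the trace itself otherwise
  let τ : K → ℝ := fun k => (P.tau k).elim (P.block k y).trace fun q => (q : ℝ)
  refine bound_core h hy τ (fun k => ?_) (le_of_eq ?_)
  · cases hq : P.tau k with
    | none => simp [τ, hq]
    | some q => simpa [τ, hq] using htr k q (by simp [hq])
  · rw [penalty, Rat.cast_sum]
    refine Finset.sum_congr rfl fun k _ => ?_
    cases hq : P.tau k with
    | none =>
        have h0 : 0 ≤ (C.wit k).dfloor := by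
          by_contra hlt
          have := hsome k (lt_of_not_ge hlt)
          simp [hq] at this
        have h0' : (0 : ℝ) ≤ ((C.wit k).dfloor : ℝ) := by exact_mod_cast h0
        simp [min_eq_left h0', min_eq_left h0]
    | some q => simp [τ, hq, Rat.cast_mul, Rat.cast_abs, Rat.cast_min]

/-- **Soundness without trace bounds**: if moreover every eigenvalue floor is `≥ 0` (in particular in
pure Gram mode), the bound holds at EVERY feasible `y`. [cite: JanssonChaykinKeil2008, Thm 3.2
(inequality-form corollary, case without penalised blocks)] [cite: BurerMonteiro2003, §1 eq. (2)] -/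
theorem sound' {P : Problem V E I K σ} {C : LowerCert V E I K σ π} (h : check P C = true)
    (h0 : ∀ k, 0 ≤ (C.wit k).dfloor) {y : V → ℝ} (hy : P.Feasible y) :
    (C.lowerBound : ℝ) ≤ P.obj y := by
  refine bound_core h hy (fun k => (P.block k y).trace) (fun k => le_rfl) ?_
  have hl : ∑ k, |min 0 ((C.wit k).dfloor : ℝ)| * (P.block k y).trace = 0 :=
    Finset.sum_eq_zero fun k _ => by
      rw [min_eq_left (show (0 : ℝ) ≤ ((C.wit k).dfloor : ℝ) by exact_mod_cast h0 k), abs_zero,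
        zero_mul]
  have hr : penalty P C = 0 :=
    Finset.sum_eq_zero fun k _ => by rw [min_eq_left (h0 k), abs_zero, zero_mul]
  rw [hl, hr, Rat.cast_zero]

/-- The accepted bound is below the INFIMUM of the objective over the feasible points satisfying the
trace bounds (nonempty such set). [cite: JanssonChaykinKeil2008, Thm 3.2 (inequality-form corollary)] -/
theorem le_csInf {P : Problem V E I K σ} {C : LowerCert V E I K σ π} (h : check P C = true)
    (hne : (P.obj '' {y | P.Feasible y ∧ P.TraceBounds y}).Nonempty) :
    (C.lowerBound : ℝ) ≤ sInf (P.obj '' {y | P.Feasible y ∧ P.TraceBounds y}) :=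
  _root_.le_csInf hne (by rintro _ ⟨y, ⟨hy, htr⟩, rfl⟩; exact sound h hy htr)

/-- Without penalised blocks: the accepted bound is below the infimum over ALL feasible points.
[cite: JanssonChaykinKeil2008, Thm 3.2 (inequality-form corollary)] -/
theorem le_csInf' {P : Problem V E I K σ} {C : LowerCert V E I K σ π} (h : check P C = true)
    (h0 : ∀ k, 0 ≤ (C.wit k).dfloor) (hne : (P.obj '' {y | P.Feasible y}).Nonempty) :
    (C.lowerBound : ℝ) ≤ sInf (P.obj '' {y | P.Feasible y}) :=
  _root_.le_csInf hne (by rintro _ ⟨y, hy, rfl⟩; exact sound' h h0 hy)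

end LowerCert

end ConicLayout

end Literature.Computation.Certificates
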